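import Literature.AnabelianGeometry.SemiGraphs.StarLinkFiniteOpen
import Literature.AnabelianGeometry.SemiGraphs.InducedAlongApproximator
import Literature.AnabelianGeometry.SemiGraphs.StarSubSemiGraphConnected

/-!
# The star-link of a covering as a finite open object of `Loc(𝔾, Γ)` — assembly modulo ONE clause ([SemiAnbd] §4 pp.51–52, Prop 4.7 p.57)

Mochizuki, *Semi-graphs of anabelioids*, Publ. RIMS **42** (2006), §4 pp.51–52 (the objects of
`Loc(𝔾, Γ)`: "A finite open object `H` is a finite, connected, quasi-coherent, totally elevated, totally
universally sub-coverticial, totally aloof, verticially slim semi-graph of anabelioids, equipped with an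
iso-immersive, verticially iso-excisive local `(𝒢, Γ)`-structure, such that `H` contains at least one
non-isolated open edge which is, however, `𝒢`-closed"), Def 4.2 (i) p.52 (links), proof of Prop 4.7 p.57
l.38–40 ("if we take `H₃` to be the link contained in `𝒢₃` which is determined by the images `v₃`, `e₃` of
`v′`, `e′` …"; print's calligraphic `𝒢`, `𝒢₃` are semi-graphs of anabelioids, the cell's `𝔾`, `𝔾₃` denote
underlying semi-graphs) (kurims `paper:url-f33ace170ff4`). [cite: MochizukiSemiAnbd2006, §4, p. 51]

DEFINITION (cell abc-iut, layer L3, seat abc-iut-L3-t12 gen 10; the ASSEMBLY of the L3 lead's row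
«PROP47@REAL-CONSTRUCTION», item (γ) «link-in-a-covering constructor», over bricks B1 `StarSubSemiGraph`,
B2 `StarLinkFiniteOpen`, B2′ `StarSubSemiGraphConnected`, B3 `InducedAlongApproximator`; SHAPES memo
`HOME/staging/L3/L3-t12/g10/SHAPES-gamma-LinkInCovering.md`): at the real vocabulary `SemiAnbdVocab.ofReal R`
(every residual `R`), for an object `X` of the ambient category over `𝔾` by a finite étale `p : X ⟶ 𝔾`
(the covering `𝒢₃ → 𝒢` of print), untangled and finite, quasi-coherent and totally elevated (for coverings
of the `𝔾` of `Loc(𝔾, Γ)` both hold BY NAME, abc-iut-L3-t3's `SgA.heredity_of_finiteEtale`), a closed edge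
`e₃` with abutments `v₃`, `v₃′`, and one further closed edge of `X` leaving `{v₃, v₃′}`:

* `SgAQuot.SgA.starLinkLocObj …` — **the FINITE OPEN OBJECT of `Loc(𝔾, Γ)` carried by the full star
  `X.starAt {v₃, v₃′}`** with the local `(𝔾, Γ)`-structure INDUCED by `X.starAt {v₃, v₃′} ⟶ X ⟶ 𝔾`
  (abc-iut-L3-t3's `LocalGStructure.induced`), its finite-open datum `IsFiniteOpenDatum` (8 clauses)
  ASSEMBLED from the bricks — isFinite (B1), isConnected (B2′), isQuasiCoherent / isTotallyElevated (B3),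
  isoImmersive / vertIsoExcisive / exists_edge (B2) — MODULO EXACTLY ONE DISPLAYED HYPOTHESIS
  `hUS : (X.starAt {v₃, v₃′}).toSgA.IsTotallyUniversallySubCoverticial` (total universal
  sub-coverticiality of the star: its heredity from `X` needs fibre products of coverings — the lead's
  unowned row (δ) — and is NOT proved in the tree);
* `starLinkLocObj_U`, `starLinkLocObj_str`, `starLinkLocObj_isFiniteOpen` — bookkeeping.

READING PROVISO (L3 lead gen 8, F106): this object is print's LINK `H₃` of Prop 4.7 (an open object of
verticial length `2` and edge-wise length `1`, Def 4.2 (i)) only when, moreover, `v₃ ≠ v₃′` and `e₃` is the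
UNIQUE closed edge of `X` joining `v₃` and `v₃′` ("untangled", §1 p.13, does not exclude parallel closed
edges); `IsLink` is not claimed here.  No instance, no notation; nothing printed is discharged (Prop 4.7
needs moreover (α) the Galois covering with isotropy, (β), the NL-lift B4 and (δ)); typed ≠ proved;
conditional ≠ discharged; nothing here takes a side on [IUTchIII] Cor. 3.12.
-/

noncomputable section

namespace Literature.AnabelianGeometry.SemiGraphs

open CategoryTheory

universe v₁ u₁ u

namespace SgAQuot.SgA

open SemiGraphOfAnabelioids Loc

variable (R : BridgeResidual.{v₁, u₁, u}) {G : SgA.{v₁, u₁, u}} (Γ : Subgroup (Aut G))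
  (X : SgA.{v₁, u₁, u}) (p : X ⟶ G) (hp : finiteEtale p.hom.hom) (hXunt : X.toSgA.graph.IsUntangled)
  (hXfin : X.toSgA.graph.IsFinite) (hXqc : X.toSgA.IsQuasiCoherent) (hXte : X.toSgA.IsTotallyElevated)
  (v₃ v₃' : X.toSgA.graph.Vertex) {e₃ : X.toSgA.graph.Edge} (b₁ b₂ : X.toSgA.graph.Branch)
  (hb₁ : X.toSgA.graph.edgeOf b₁ = e₃) (hb₂ : X.toSgA.graph.edgeOf b₂ = e₃)
  (h₁ : X.toSgA.graph.abuts b₁ = some v₃) (h₂ : X.toSgA.graph.abuts b₂ = some v₃')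
  (e₀ : X.toSgA.graph.Edge) (he₀ : X.toSgA.graph.IsClosedEdge e₀) (c₁ c₂ : X.toSgA.graph.Branch)
  (hc₁ : X.toSgA.graph.edgeOf c₁ = e₀) (hc₂ : X.toSgA.graph.edgeOf c₂ = e₀) (w : X.toSgA.graph.Vertex)
  (hw : w ∈ ({v₃, v₃'} : Set X.toSgA.graph.Vertex)) (hin : X.toSgA.graph.abuts c₁ = some w)
  (hout : ∀ u ∈ ({v₃, v₃'} : Set X.toSgA.graph.Vertex), X.toSgA.graph.abuts c₂ ≠ some u)
  (hUS : (X.starAt {v₃, v₃'}).toSgA.IsTotallyUniversallySubCoverticial)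

/-- A finite semi-graph is locally finite. [cite: MochizukiSemiAnbd2006, §1, p. 13] -/
theorem isLocallyFinite_of_isFinite {X : SgA.{v₁, u₁, u}} (h : X.toSgA.graph.IsFinite) :
    X.toSgA.graph.IsLocallyFinite := by
  haveI := h.finite_edge
  exact ⟨fun _ => Set.toFinite _⟩

include hp in
/-- The `𝔾`-structure `X.starAt {v₃, v₃′} ⟶ X ⟶ 𝔾` of the star is locally finite étale.
[cite: MochizukiSemiAnbd2006, §4, p. 51] -/
theorem locallyFiniteEtale_starLinkHom (S : Set X.toSgA.graph.Vertex) :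
    (SemiAnbdVocab.ofReal R).IsLocallyFiniteEtale (X.starAtHom S ≫ p) :=
  X.locallyFiniteEtale_starAtHom_comp R S p (locallyFiniteEtale_of_finiteEtale hp)

/-- **The star-link of the covering `p : X ⟶ 𝔾` at the closed edge `e₃` (abutments `v₃`, `v₃′`) as a
FINITE OPEN OBJECT of `Loc(𝔾, Γ)`** at the real vocabulary: underlying semi-graph of anabelioids the full
star `X.starAt {v₃, v₃′}` (brick B1), local `(𝔾, Γ)`-structure induced by `X.starAt {v₃, v₃′} ⟶ X ⟶ 𝔾`,
no `𝔾`-structure (`str = none`), finite-open datum assembled from bricks B1/B2/B2′/B3 modulo the ONE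
displayed hypothesis `hUS` (total universal sub-coverticiality of the star).  Print's link `H₃` of
Prop 4.7 when moreover `e₃` is the unique closed edge joining `v₃ ≠ v₃′` (F106 proviso; not used here).
[cite: MochizukiSemiAnbd2006, §4, p. 51] -/
def starLinkLocObj : LocObj (SemiAnbdVocab.ofReal R) G Γ where
  U := X.starAt {v₃, v₃'}
  L := LocalGStructure.induced (SemiAnbdVocab.ofReal R) (Γ := Γ) (X.starAtHom {v₃, v₃'} ≫ p)
    (locallyFiniteEtale_starLinkHom R X p hp {v₃, v₃'})
  str := none
  tempered_wf := fun _ h => by cases h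
  finOpen_wf := fun _ =>
    { isFinite := (SemiAnbdVocab.ofReal_isFinite_iff R _).mpr
        (X.starAt_isFinite {v₃, v₃'} (isLocallyFinite_of_isFinite hXfin) (Set.toFinite _))
      isConnected := X.starAt_isConnected_pair_ofReal R v₃ v₃' b₁ b₂ hb₁ hb₂ h₁ h₂
      isQuasiCoherent := X.starAt_isQuasiCoherent {v₃, v₃'} hXqc
      isTotallyElevated := X.starAt_isTotallyElevated {v₃, v₃'} hXte
      isTotallyUnivSubcoverticial := hUS
      isoImmersive := X.isIsoImmersive_induced_starAt R {v₃, v₃'} p Γ hp hXunt _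
      vertIsoExcisive := X.isVerticiallyIsoExcisive_induced_starAt R {v₃, v₃'} p Γ hp hXunt _
      exists_edge := X.exists_open_gClosed_edge_starAt R {v₃, v₃'} p Γ hp _ e₀ he₀ c₁ c₂ hc₁ hc₂ w hw
        hin hout }

/-- The underlying semi-graph of anabelioids of the star-link object is the full star `X.starAt {v₃, v₃′}`.
[cite: MochizukiSemiAnbd2006, §4, p. 51] -/
@[simp] theorem starLinkLocObj_U :
    (starLinkLocObj R Γ X p hp hXunt hXfin hXqc hXte v₃ v₃' b₁ b₂ hb₁ hb₂ h₁ h₂ e₀ he₀ c₁ c₂ hc₁ hc₂ w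
      hw hin hout hUS).U = X.starAt {v₃, v₃'} := rfl

/-- The star-link object has no `𝔾`-structure (it is not a tempered object).
[cite: MochizukiSemiAnbd2006, §4, p. 51] -/
@[simp] theorem starLinkLocObj_str :
    (starLinkLocObj R Γ X p hp hXunt hXfin hXqc hXte v₃ v₃' b₁ b₂ hb₁ hb₂ h₁ h₂ e₀ he₀ c₁ c₂ hc₁ hc₂ w
      hw hin hout hUS).str = none := rfl

/-- **The star-link object is a FINITE OPEN object of `Loc(𝔾, Γ)`.** [cite: MochizukiSemiAnbd2006, §4, p. 51] -/
theorem starLinkLocObj_isFiniteOpen :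
    (starLinkLocObj R Γ X p hp hXunt hXfin hXqc hXte v₃ v₃' b₁ b₂ hb₁ hb₂ h₁ h₂ e₀ he₀ c₁ c₂ hc₁ hc₂ w
      hw hin hout hUS).IsFiniteOpen (SemiAnbdVocab.ofReal R) := rfl

/-- The local `(𝔾, Γ)`-structure of the star-link object is the one INDUCED by its arrow to `𝔾`
(p.51: structures "compatible" with `X.starAt {v₃, v₃′} ⟶ X ⟶ 𝔾`; Def 4.1 (iv)). [cite: MochizukiSemiAnbd2006, Def 4.1 (iv), p. 51] -/
theorem starLinkLocObj_L :
    (starLinkLocObj R Γ X p hp hXunt hXfin hXqc hXte v₃ v₃' b₁ b₂ hb₁ hb₂ h₁ h₂ e₀ he₀ c₁ c₂ hc₁ hc₂ w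
      hw hin hout hUS).L =
      LocalGStructure.induced (SemiAnbdVocab.ofReal R) (Γ := Γ) (X.starAtHom {v₃, v₃'} ≫ p)
        (locallyFiniteEtale_starLinkHom R X p hp {v₃, v₃'}) := rfl

end SgAQuot.SgA

end Literature.AnabelianGeometry.SemiGraphs

end
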